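import Summits.NavierStokesRegularity.NavierStokesRegularity.Theses.AxisymmetricExtremality
import Summits.NavierStokesRegularity.NavierStokesRegularity.Theorems.AxisymmetricExtremalityPFoldToAxisymmetric

/-!
# Disproof of `PFoldToAxisymmetric` — findings: NO KILL POSSIBLE, the crux is a THEOREM of the tree

Crux item stmt-NavierStokesRegularity-15454 (route `AxisymmetricExtremality`, rank 4), disprover seat
`refuter-cdisprove-stmt-NavierStokesRegularity-15454-0`, cycle 1 (2026-08-17, seated 09:09Z).

## Terminal state found at seat start

The item was CLOSED `proved` at 2026-08-17T09:05:59Z — four minutes before this seat started — by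
`Summit.NavierStokesRegularity.NavierStokesRegularity.Theorems.axisymmetricExtremality_pFoldToAxisymmetric_proof`
(proposal p150273, file `Theorems/AxisymmetricExtremalityPFoldToAxisymmetric.lean`, line `birth`:
stubs `stub_compactModuloSim` p146603, `stub_axisPinning` p149431 (= `stub_motionRigidity` p149118 +
`stub_offsetsBounded` p149273), `stub_denseAngleClosure` p148393, `stub_aeAxisymmetricUpgrade` p146797).

Adversarial re-check done here (the only attack left against a closed crux): the closing theorem has
LITERALLY the crux's type (term-mode `probe` below, no unfolding) and its axiom closure is exactly
`propext, Classical.choice, Quot.sound` (`lean check --axioms`, rc 0, no `sorryAx`, no extra axiom).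
Hence `¬ PFoldToAxisymmetric` is itself refutable (`not_not_pFoldToAxisymmetric`), and every
`…Without<H>` weakening whose conclusion is still implied by the crux is moot.

## Why no refutation could have existed even before the proof (a-priori analysis, for the record)

* An unconditional `¬ PFoldToAxisymmetric` needs the HYPOTHESIS to hold at some `ν > 0`, i.e. a
  `p`-fold symmetric `IsMinimalBlowupDatum ν u₀ g`; that conjunction contains
  `‖g‖ₑ = rusinSverakRhoMaxPure ν` (so `ρ_max^pure(ν) < ⊤`) and `¬ HasGlobalKatoSolution ν u₀` —
  a Navier–Stokes blow-up in the Kato class. Not constructible; if `ρ_max^pure = ⊤` the crux is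
  vacuously true.
* The planner's feared model counterexample (symmetry axes escaping to infinity after Rusin–Šverák
  modulation) self-destructs WITHOUT any axis-pinning hypothesis: with angle `θ_j = 2π/p_j → 0` and
  horizontal axis offset `c_j`, (i) `|c_j| → ∞` with `θ_j|c_j| ↛ 0` gives unboundedly many pairwise
  disjoint isometric copies of any ball carrying `L³`-mass of the non-zero limit — contradicts strong
  `L³` convergence; (ii) `|c_j| → ∞` with `θ_j|c_j| → 0` makes iterates `g_j^{m_j}` converge to a
  non-zero horizontal translation fixing the limit — a translation-periodic `L³` field is `0`,
  contradicting `u ∈ M ⇒ ‖u‖₃ ≠ 0` (zero datum is Kato-global); (iii) bounded `c_j` ⇒ dense angles ⇒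
  a.e.-axisymmetric limit ⇒ everywhere-axisymmetric representative in `M`. This is exactly what the
  landed stubs prove (`stub_motionRigidity`, `stub_offsetsBounded`, `stub_denseAngleClosure`,
  `stub_aeAxisymmetricUpgrade`).
* Junk/degenerate probes (all harmless): `p ∈ {0,1}` excluded by `2 ≤ p` (for `p = 0` Lean's
  `2π/0 = 0` would make the symmetry clause vacuous); `u₀ = 0` is never minimal; the symmetry clauses
  are pointwise while `IsMinimalBlowupDatum` is a.e.-invariant (`isMinimalBlowupDatum_congr_ae`,
  landed) — handled by stub 4, not exploitable.

No `Negative/*` lemma is filed: the crux is no longer a live leaf (anti-leakage rule), and any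
`¬`-statement about it is now inconsistent with the tree.
-/

-- single-conjunct summit: `Summit.<Summit>.<Problem>` repeats the name by the D-0017 layout
set_option linter.dupNamespace false

namespace Summit.NavierStokesRegularity.NavierStokesRegularity.Cruxes.PFoldToAxisymmetric.Disproof

/-- The closing theorem has literally the crux's type (term-mode, no unfolding); axiom closure
re-checked by this seat: `propext, Classical.choice, Quot.sound`. -/
theorem probe :
    Summit.NavierStokesRegularity.NavierStokesRegularity.Theses.AxisymmetricExtremality.PFoldToAxisymmetric :=
  Summit.NavierStokesRegularity.NavierStokesRegularity.Theorems.axisymmetricExtremality_pFoldToAxisymmetric_proof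

/-- **No disproof exists**: the negation of the crux is refutable in the tree (the crux is proved,
p150273), so every attempted `¬ PFoldToAxisymmetric` is inconsistent. Terminal record of the
disprover seat, cycle 1. -/
theorem not_not_pFoldToAxisymmetric :
    ¬ ¬ Summit.NavierStokesRegularity.NavierStokesRegularity.Theses.AxisymmetricExtremality.PFoldToAxisymmetric :=
  fun h => h probe

/-- The converse direction of the crux is trivial (an axisymmetric minimal datum is `p`-fold
symmetric for every `p`), so with the crux proved the two sides are EQUIVALENT for every `ν > 0`:
recorded to show the statement was not a one-sided weakening. -/
theorem pFold_hypothesis_iff_axisymmetric_conclusion (ν : ℝ) (hν : 0 < ν) :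
    (∀ N : ℕ, ∃ p : ℕ, N ≤ p ∧ 2 ≤ p ∧ ∃ (u₀ : EuclideanSpace ℝ (Fin 3) → EuclideanSpace ℝ (Fin 3))
      (g : Literature.Analysis.FunctionSpaces.HomSobolev (EuclideanSpace ℝ (Fin 3))
        (EuclideanSpace ℂ (Fin 3)) (1 / 2 : ℝ)),
      Literature.Analysis.FluidPDE.IsMinimalBlowupDatum ν u₀ g ∧ ∀ x : EuclideanSpace ℝ (Fin 3),
        u₀ (WithLp.toLp 2 ![Real.cos (2 * Real.pi / p) * x 0 - Real.sin (2 * Real.pi / p) * x 1,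
          Real.sin (2 * Real.pi / p) * x 0 + Real.cos (2 * Real.pi / p) * x 1, x 2]) =
        WithLp.toLp 2 ![Real.cos (2 * Real.pi / p) * u₀ x 0 - Real.sin (2 * Real.pi / p) * u₀ x 1,
          Real.sin (2 * Real.pi / p) * u₀ x 0 + Real.cos (2 * Real.pi / p) * u₀ x 1, u₀ x 2]) ↔
    (∃ (u₀ : EuclideanSpace ℝ (Fin 3) → EuclideanSpace ℝ (Fin 3))
      (g : Literature.Analysis.FunctionSpaces.HomSobolev (EuclideanSpace ℝ (Fin 3))
        (EuclideanSpace ℂ (Fin 3)) (1 / 2 : ℝ)),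
      Literature.Analysis.FluidPDE.IsMinimalBlowupDatum ν u₀ g ∧
        ∀ (θ : ℝ) (x : EuclideanSpace ℝ (Fin 3)),
          u₀ (WithLp.toLp 2 ![Real.cos θ * x 0 - Real.sin θ * x 1,
            Real.sin θ * x 0 + Real.cos θ * x 1, x 2]) =
          WithLp.toLp 2 ![Real.cos θ * u₀ x 0 - Real.sin θ * u₀ x 1,
            Real.sin θ * u₀ x 0 + Real.cos θ * u₀ x 1, u₀ x 2]) := by
  constructor
  · exact probe ν hν
  · rintro ⟨u₀, g, hmin, hax⟩ N
    exact ⟨max N 2, le_max_left _ _, le_max_right _ _, u₀, g, hmin, fun x => hax _ x⟩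

end Summit.NavierStokesRegularity.NavierStokesRegularity.Cruxes.PFoldToAxisymmetric.Disproof
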